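import Summits.Ventures.LatticeQCDFlow.Scaling.CompositionProductBracket

/-!
HONEST FRAMING: exact (Metropolis-corrected) sampling algorithms for lattice gauge theory; figures
of merit are autocorrelation/cost numbers at stated couplings and volumes; no continuum-physics
claim.

# FiniteOddsMixtureReduction — AT SWAP ODDS `σ` THE END-HUB LAWS ARE `u = (1−σ)δ_z + σũ`; COUPLING THE NO-ATTEMPT BRANCH DIAGONALLY AND THE TAIL LAWS BY ANY `q̃`, THE PRODUCT
# CRITERION OF CHAPTER V FILE 5 REDUCES TO `ρΔΦ + (1−σ)Δ(e − 2r_z) ≤ σ·[G̃(Φ + e − 2r_max) + Δ(R̃_X + R̃_Y − e)]`, AND FOR HUB WEIGHTS WITH `e = 2(1−σ)r_z + 2σr̄` TO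
# `ρΔΦ ≤ σ·[G̃(Φ + e − 2r_max) + Δ(R̃_X + R̃_Y − 2r̄)]` — THE SWAP ODDS ENTER ONLY AS THE FACTOR `σ` AND THROUGH THE TAIL LAWS (lean-2 GEN-36, ours)

Venture-side (OURS).  Cell `lqcd-flow` (pub-lqcd), unit `pub-lqcd-lean-2-g36`, 2026-08-29.  Chapter W (item 1 (i) at finite swap odds), file 5 — MEMO-gen35 §7's first display,
typed.  One pair state of the lumped star with a common hub content `z`: the two end-hub laws are `u_X = (1−σ)δ_z + σũ_X`, `u_Y = (1−σ)δ_z + σũ_Y` (`Scaling/ResolventLaw`,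
`geomResolvent_decomp`: `ũ = uK` the law after at least one attempt).  Couple them by `q = (1−σ)δ_(z,z) + σq̃` with `q̃` ANY coupling of the tail laws (`mixture_isCoupling`):
the no-attempt branch deletes the common hub content in both copies, which leaves the distance unchanged (`Δ'(z,z) = Δ`) and changes the mass by `e − 2r_z`.  Hence for the
product potential `Ψ = Δ·Φ` of chapter V file 5 (`Φ' = Φ + e − r_a − r_b`): `E_q[Δ'Φ'] = (1−σ)Δ(Φ + e − 2r_z) + σ·E_q̃[Δ'Φ']` (`mixture_product_split`), and with the monotone
bracket of file 5 for `q̃` the contraction `E_q[Δ'Φ'] ≤ (1−ρ)ΔΦ` follows from **`ρΔΦ + (1−σ)Δ(e − 2r_z) ≤ σ·[G̃(Φ + e − 2r_max) + Δ(R̃_X + R̃_Y − e)]`**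
(`mixture_product_contract`; `G̃ = Δ − E_q̃Δ'`, `R̃ = E_ũ r`).  When the hub particle carries the `σ`-discounted weight (any weights with `e = 2(1−σ)r_z + 2σr̄`, e.g. `Ψ_σ` of
MEMO-gen35 §5: `r = θ`, extra hub weight `−(1−σ)θ_z`), the no-attempt cost is absorbed: **`ρΔΦ ≤ σ·[G̃(Φ + e − 2r_max) + Δ(R̃_X + R̃_Y − 2r̄)]`** (`finiteOdds_product_contract`).
One pair state, hypothesis-equations, no chain, no definitions; the lumped-chain frame that consumes it is `Scaling/LumpedCycleAnyCoupling`.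

## What is proved

* §1 `mixture_nonneg`, `mixture_sum`, **`mixture_isCoupling`**, **`mixture_functional`**.
* §2 **`mixture_product_split`**, **`mixture_product_contract`**, **`finiteOdds_product_contract`**, `finiteOdds_criterion_iff` (the two criteria are the same number).

Reading (no numerics implied): what remains of item 1 (i) at swap odds `σ` is a lower bound `c·p` for `G̃(Φ+e−2)/Δ + R̃_X + R̃_Y − 2θ̄` with the TAIL laws — by
`Scaling/ResolventPairCoupling` one sub-solution on hub pairs.  NOT CLAIMED: that bound.  Literature grade (cell rule): OWN, elementary; nothing cited as a fact; no new bib keys.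
-/

open Finset
open Literature.Probability.MarkovChains

namespace Summit.Ventures.LatticeQCDFlow.Scaling

section Mixture
variable {S : Type*} [Fintype S] [DecidableEq S]
variable {σ : ℝ} {z : S} {utX utY uX uY : S → ℝ} {qt q : S → S → ℝ}

/-! ## §1 The mixture coupling -/

omit [Fintype S] in
/-- The mixture `q = (1−σ)δ_(z,z) + σq̃` is non-negative (`0 ≤ σ ≤ 1`, `q̃ ≥ 0`). [ours] -/
theorem mixture_nonneg (hσ0 : 0 ≤ σ) (hσ1 : σ ≤ 1) (hqt0 : ∀ a b, 0 ≤ qt a b)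
    (hq : ∀ a b, q a b = (1 - σ) * ((if a = z then (1 : ℝ) else 0) * (if b = z then (1 : ℝ) else 0)) + σ * qt a b) (a b : S) : 0 ≤ q a b := by
  rw [hq]
  exact add_nonneg (mul_nonneg (by linarith) (mul_nonneg (by split_ifs <;> norm_num) (by split_ifs <;> norm_num))) (mul_nonneg hσ0 (hqt0 a b))

/-- A mixture law `u = (1−σ)δ_z + σũ` has the mass of `ũ` when `Σ ũ = 1`. [ours] -/
theorem mixture_sum (hut : ∑ a, utX a = 1) (hu : ∀ a, uX a = (1 - σ) * (if a = z then (1 : ℝ) else 0) + σ * utX a) : ∑ a, uX a = 1 := by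
  simp_rw [hu]
  rw [sum_add_distrib, ← mul_sum, ← mul_sum, hut]
  simp

/-- **`q = (1−σ)δ_(z,z) + σq̃` couples `u_X = (1−σ)δ_z + σũ_X` with `u_Y = (1−σ)δ_z + σũ_Y`** whenever `q̃` couples `ũ_X` with `ũ_Y` (`0 ≤ σ ≤ 1`). [ours] -/
theorem mixture_isCoupling (hσ0 : 0 ≤ σ) (hσ1 : σ ≤ 1) (hqt : IsCoupling utX utY qt)
    (huX : ∀ a, uX a = (1 - σ) * (if a = z then (1 : ℝ) else 0) + σ * utX a)
    (huY : ∀ b, uY b = (1 - σ) * (if b = z then (1 : ℝ) else 0) + σ * utY b)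
    (hq : ∀ a b, q a b = (1 - σ) * ((if a = z then (1 : ℝ) else 0) * (if b = z then (1 : ℝ) else 0)) + σ * qt a b) :
    IsCoupling uX uY q := by
  refine ⟨mixture_nonneg hσ0 hσ1 hqt.1 hq, fun a => ?_, fun b => ?_⟩
  · simp_rw [hq]
    rw [sum_add_distrib, ← mul_sum, ← mul_sum, ← mul_sum, hqt.2.1 a, huX a]
    simp
  · simp_rw [hq]
    rw [sum_add_distrib, ← mul_sum, ← mul_sum, hqt.2.2 b, huY b]
    congr 1
    rw [show (∑ a, (if a = z then (1 : ℝ) else 0) * (if b = z then (1 : ℝ) else 0)) = (∑ a, (if a = z then (1 : ℝ) else 0)) * (if b = z then (1 : ℝ) else 0) by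
      rw [sum_mul]]
    simp

/-- **Pair functionals split:** `Σ_{a,b} q(a,b)φ(a,b) = (1−σ)φ(z,z) + σ·Σ_{a,b} q̃(a,b)φ(a,b)`. [ours] -/
theorem mixture_functional (hq : ∀ a b, q a b = (1 - σ) * ((if a = z then (1 : ℝ) else 0) * (if b = z then (1 : ℝ) else 0)) + σ * qt a b)
    (φ : S → S → ℝ) : ∑ a, ∑ b, q a b * φ a b = (1 - σ) * φ z z + σ * ∑ a, ∑ b, qt a b * φ a b := by
  have h : ∀ a b, q a b * φ a b = (1 - σ) * ((if a = z then (1 : ℝ) else 0) * (if b = z then (1 : ℝ) else 0) * φ a b) + σ * (qt a b * φ a b) := by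
    intro a b; rw [hq]; ring
  simp_rw [h, sum_add_distrib, ← mul_sum]
  congr 1
  congr 1
  simp_rw [ite_mul, one_mul, zero_mul]
  simp [Finset.sum_ite_eq']

/-! ## §2 The product criterion at swap odds `σ` -/

variable {Dn : S → S → ℝ} {r : S → ℝ} {D Φ e rmax ρ rbar : ℝ}

/-- **`E_q[Δ'Φ'] = (1−σ)Δ(Φ + e − 2r_z) + σ·E_q̃[Δ'Φ']`** (the common deletion of the hub content leaves the distance unchanged: `Δ'(z,z) = Δ`). [ours] -/
theorem mixture_product_split (hq : ∀ a b, q a b = (1 - σ) * ((if a = z then (1 : ℝ) else 0) * (if b = z then (1 : ℝ) else 0)) + σ * qt a b)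
    (hDz : Dn z z = D) :
    ∑ a, ∑ b, q a b * (Dn a b * (Φ + e - r a - r b)) = (1 - σ) * (D * (Φ + e - 2 * r z)) + σ * ∑ a, ∑ b, qt a b * (Dn a b * (Φ + e - r a - r b)) := by
  rw [mixture_functional hq, hDz]; ring

/-- **THE PRODUCT CRITERION AT SWAP ODDS `σ`.**  `q̃` a coupling of the tail laws (`Σ ũ_X = 1`), monotone on its support (`Δ' ≤ Δ`), weights `0 ≤ r ≤ r_max`, `0 ≤ σ ≤ 1`; if
`ρΔΦ + (1−σ)Δ(e − 2r_z) ≤ σ·[G̃(Φ + e − 2r_max) + Δ(R̃_X + R̃_Y − e)]` (`G̃ = Δ − E_q̃Δ'`, `R̃ = E_ũ r`) then the mixture coupling has `E_q[Δ'Φ'] ≤ (1−ρ)ΔΦ`. [ours] -/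
theorem mixture_product_contract (hσ0 : 0 ≤ σ) (hqt : IsCoupling utX utY qt) (hut : ∑ a, utX a = 1)
    (hq : ∀ a b, q a b = (1 - σ) * ((if a = z then (1 : ℝ) else 0) * (if b = z then (1 : ℝ) else 0)) + σ * qt a b)
    (hDz : Dn z z = D) (hr0 : ∀ v, 0 ≤ r v) (hrmax : ∀ v, r v ≤ rmax) (hmono : ∀ a b, qt a b ≠ 0 → Dn a b ≤ D)
    (hcrit : ρ * D * Φ + (1 - σ) * D * (e - 2 * r z)
      ≤ σ * ((D - ∑ a, ∑ b, qt a b * Dn a b) * (Φ + e - 2 * rmax) + D * (∑ a, utX a * r a + ∑ b, utY b * r b - e))) :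
    ∑ a, ∑ b, q a b * (Dn a b * (Φ + e - r a - r b)) ≤ (1 - ρ) * D * Φ := by
  rw [mixture_product_split hq hDz]
  have hb := product_bracket_le_of_monotone qt Dn utX utY r D Φ e rmax hqt.1 hqt.2.1 hqt.2.2 hut hr0 hrmax hmono
  have hb' := mul_le_mul_of_nonneg_left hb hσ0
  nlinarith

omit [Fintype S] [DecidableEq S] in
/-- **THE `σ`-DISCOUNTED HUB WEIGHT ABSORBS THE NO-ATTEMPT BRANCH:** if the insertion term is `e = 2(1−σ)r_z + 2σr̄` then the criterion of `mixture_product_contract` reads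
`ρΔΦ ≤ σ·[G̃(Φ + e − 2r_max) + Δ(R̃_X + R̃_Y − 2r̄)]`. [ours] -/
theorem finiteOdds_criterion_iff (he : e = 2 * (1 - σ) * r z + 2 * σ * rbar) (Gt RX RY : ℝ) :
    ρ * D * Φ + (1 - σ) * D * (e - 2 * r z) ≤ σ * (Gt * (Φ + e - 2 * rmax) + D * (RX + RY - e))
      ↔ ρ * D * Φ ≤ σ * (Gt * (Φ + e - 2 * rmax) + D * (RX + RY - 2 * rbar)) := by
  rw [he]; constructor <;> intro h <;> nlinarith

/-- **THE FINITE-ODDS PRODUCT CRITERION** (MEMO-gen35 §7): with `e = 2(1−σ)r_z + 2σr̄`, a monotone coupling `q̃` of the tail laws, `0 ≤ r ≤ r_max`, `0 ≤ σ ≤ 1`,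
`ρΔΦ ≤ σ·[G̃(Φ + e − 2r_max) + Δ(R̃_X + R̃_Y − 2r̄)]` ⇒ `E_q[Δ'Φ'] ≤ (1−ρ)ΔΦ` for `q = (1−σ)δ_(z,z) + σq̃`. [ours] -/
theorem finiteOdds_product_contract (hσ0 : 0 ≤ σ) (hqt : IsCoupling utX utY qt) (hut : ∑ a, utX a = 1)
    (hq : ∀ a b, q a b = (1 - σ) * ((if a = z then (1 : ℝ) else 0) * (if b = z then (1 : ℝ) else 0)) + σ * qt a b)
    (hDz : Dn z z = D) (hr0 : ∀ v, 0 ≤ r v) (hrmax : ∀ v, r v ≤ rmax) (hmono : ∀ a b, qt a b ≠ 0 → Dn a b ≤ D)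
    (he : e = 2 * (1 - σ) * r z + 2 * σ * rbar)
    (hcrit : ρ * D * Φ ≤ σ * ((D - ∑ a, ∑ b, qt a b * Dn a b) * (Φ + e - 2 * rmax) + D * (∑ a, utX a * r a + ∑ b, utY b * r b - 2 * rbar))) :
    ∑ a, ∑ b, q a b * (Dn a b * (Φ + e - r a - r b)) ≤ (1 - ρ) * D * Φ :=
  mixture_product_contract hσ0 hqt hut hq hDz hr0 hrmax hmono
    ((finiteOdds_criterion_iff he (D - ∑ a, ∑ b, qt a b * Dn a b) (∑ a, utX a * r a) (∑ b, utY b * r b)).mpr hcrit)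

end Mixture

end Summit.Ventures.LatticeQCDFlow.Scaling
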